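/-
Copyright: b2b-lace packet (CARVER gen 55).  [FvdH17] §5.1 "Elements of the bounds" with §6.1 p. 59 / App. B row
`(1,2)`: the ENTRY INEQUALITY for the CLASS-AVERAGED element `(Ā^ι)^{avg}_{1,2}` (in-class `1̲` averaged over the
`2d` unit in-offsets, out-class `2` supremised) through the `(2,2)` inner sum `2dp (D ⋆ τ_p^{⋆2})`, the neighbour
average (one more `D`), the landed Fourier cell `(D^{⋆2} ⋆ τ_p^{⋆2})(y) ≤ Γ̄₂² K_{2,2}(y)` and `K_{2,2}(y) ≤ K_{2,2}(0)`.
Proofs only; no named fact; no numeral; no dimension.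
-/
import Literature.Probability.FitznerVanDerHofstad2017.NobleEntryAbarIotaTwoTwo
import Literature.Probability.FitznerVanDerHofstad2017.NobleBoundsN1Cls22
import Literature.Probability.FitznerVanDerHofstad2017.NobleBlocksAvgPerc
import HarnessLib

/-!
# The class-averaged entry `(Ā^ι)_{1,2}` of the percolation bounding matrix: `≤ 2dp · Γ̄₂² · K_{2,2}(0)`

[FvdH17] §5.1 "Elements of the bounds" (arXiv:1506.07977v2 p. 49) defines `(Ā^ι)_{a,b}` as a supremum over the
in-offset `v` and the out-offset; §6.1 p. 59 adds "When a = 1 and/or b = 1, we include the information that either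
u,w and/or z,t are neighbors", which the Mathematica notebook `Percolation.nb` implements for the class-`1̲` slots as
the AVERAGE over the `2d` unit offsets (`BlockSummationAvg.matAbarAvg`, in-class `1` ↦ `avgOn (unitVecs d)`).

For the entry `(a,b) = (1,2)` (in-class `1̲` averaged over `v ∈ unitVecs d`, out-class `2` supremised over `y`) the
App.-B row `(1,2)` of `Ā^{ι,1,2}(0,v,x,y) = p⁻¹ 𝓢_{0,1̲,1̲,0}(v−y, −y, e_κ−y, x−y)` ([FvdH17] App. B p. 78) gives at
`Letters.perc d p`, for a unit in-offset `v = e_ι′` (`τ_{1̲}(−e_ι′) = τ_{1̲}(e_κ) = p`),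
`Σ_x Σ_κ Ā^{κ,1,2}(0,e_ι′,x,x+y) = Σ_x Σ_κ p τ_p(x − e_κ) τ_p(e_ι′ − y − x) = 2dp (D ⋆ τ_p^{⋆2})(e_ι′ − y)`
(the inner sum of the entry `(2,2)`, `perc_abarIota22_inner_eq_ofReal`), hence averaging over the `2d` unit vectors
`(2d)⁻¹ Σ_ι′ 2dp (D ⋆ τ_p^{⋆2})(e_ι′ − y) = 2dp (D^{⋆2} ⋆ τ_p^{⋆2})(y) ≤ 2dp Γ̄₂² K_{2,2}(y) ≤ 2dp Γ̄₂² K_{2,2}(0)`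
by the simple-diagram bound [FvdH-NoBLE] (5.26) (`srwConvTau_le_nobleSup2_pow_mul_srwK (n := 2) (m := 2)`,
`2·2+1 ≤ d`) and `K_{2,2}(y) ≤ K_{2,2}(0)` (`srwK_le_srwK_zero`). This is the notebook's cell
`Bound[AiotaBar,1,2,s] = (2d z) Γ̄₂² K_{2,2}(0)` read at `z = p` — one more `D` than the printed-supremum reading
`2dp Γ̄₂² K_{2,1}(0)` of `NobleEntryAbarIotaTwoTwo` (the gain of the average over the in-offset).

Main results: `perc_blockAbar'_one_two_stepVec` (§A, the block at a unit in-offset), `perc_openGap_abar12_stepVec`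
(§B), `sum_stepVec_sub_eq_two_d_mul_srwConvTau_two_two` (§B, the neighbour average produces `D^{⋆2} ⋆ τ_p^{⋆2}`),
`perc_abarAvg12_member_le` (§C), `perc_matAbarAvg'_one_two_le_ofReal_sup2` / `_le_ofReal` / `_le_ofReal_printed` (§D,
for any class selector `avg` with `avg 1 = true`, `avg 2 = false`, e.g. `fun a => decide (a = 1)`), stated for the
primed family `blockAbar'` of `NobleBlocksPrime` (which differs from App. B only at `(0,0)`); the additive family
`blockAbar''` of `NobleBlocksDoublePrime` agrees with `blockAbar'` at `(1,2)` (`blockAbar''_of_ne`), so the same bound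
transfers verbatim (recorded by the consumer, which imports that module).
-/

namespace Literature.Probability.FitznerVanDerHofstad2017

open MeasureTheory Finset
open scoped BigOperators ENNReal
open Literature.Probability.LatticeModels Literature.Probability.Percolation
open Literature.Barriers.CriticalPhenomena
open Literature.Barriers.CriticalPhenomena.SpreadOutIsing (latticeConv convPow latticeConv_comm convPow_one_eq
  latticeConv_assoc_of_bdd abs_latticeConv_le_of_bdd)
open Literature.Probability.FitznerVanDerHofstad2017.NobleBlocks
open Literature.Probability.FitznerVanDerHofstad2017.BlockSummation

variable {d : ℕ}

/-! ## A. The row `(1,2)` of `Ā^{κ}` at a unit in-offset, percolation letters -/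

/-- **The `(1,2)` block at a unit in-offset**: at `Letters.perc d p`, for `v = e_ι′` and out-point `x + y`,
`Ā'^{κ,1,2}(0, e_ι′, x, x+y) = p⁻¹ · τ_p(e_ι′ − y − x) · τ_{1̲}(−e_ι′) · τ_{1̲}(e_κ) · τ_p(x − e_κ) = p · τ_p(x − e_κ) · τ_p(e_ι′ − y − x)`
(App. B row (1,2): `p⁻¹ 𝓢_{0,1̲,1̲,0}(v−y′, −y′, e_κ−y′, x−y′)` with `y′ = x + y`; `τ_{1̲}(±e) = p`,
`perc_tau_eq_one_stepVec`; at `p = 0` both sides vanish). The primed family agrees with App. B off `(0,0)`.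
[cite: FitznerVanDerHofstad2017, App. B Table "Ā^{ι,a,b}(0,v,x,y)" row (1,2) (arXiv:1506.07977v2 p. 78); §4.2 (4.1), (4.9) (p. 34)] -/
theorem perc_blockAbar'_one_two_stepVec (p : unitInterval) (κ ι : Fin d × Bool) (x y : Site d) :
    blockAbar' (Letters.perc d p) κ 1 2 0 (stepVec ι) x (x + y) =
      (Letters.perc d p).p * (Letters.perc d p).tau (.ge 0) (x - stepVec κ) *
        (Letters.perc d p).tau (.ge 0) (stepVec ι - y - x) := by
  rw [blockAbar'_of_ne _ _ (show ¬((1 : Fin 3) = 0 ∧ (2 : Fin 3) = 0) by decide), blockAbar, ofBase_zero]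
  show (Letters.perc d p).p⁻¹ * (Letters.perc d p).Sst (.ge 0) (.eq 1) (.eq 1) (.ge 0)
      (stepVec ι - (x + y)) (-(x + y)) (stepVec κ - (x + y)) (x - (x + y)) = _
  simp only [Letters.Sst, Letters.Tst, Letters.Bst]
  have e1 : -(x + y) - (stepVec ι - (x + y)) = stepVec (srev ι) := by rw [stepVec_srev]; abel
  have e2 : stepVec κ - (x + y) - -(x + y) = stepVec κ := by abel
  have e3 : x - (x + y) - (stepVec κ - (x + y)) = x - stepVec κ := by abel
  have e4 : stepVec ι - (x + y) = stepVec ι - y - x := by abel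
  rw [e1, e2, e3, e4, perc_tau_eq_one_stepVec, perc_tau_eq_one_stepVec, perc_p]
  by_cases hp0 : (p : ℝ) ≤ 0
  · rw [ENNReal.ofReal_of_nonpos hp0]
    simp
  · have hq0 : ENNReal.ofReal (p : ℝ) ≠ 0 := by rwa [Ne, ENNReal.ofReal_eq_zero]
    set q := ENNReal.ofReal (p : ℝ)
    set A := (Letters.perc d p).tau (.ge 0) (stepVec ι - y - x)
    set B := (Letters.perc d p).tau (.ge 0) (x - stepVec κ)
    calc q⁻¹ * (A * q * q * B) = q⁻¹ * q * (q * B * A) := by ring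
      _ = q * B * A := by rw [ENNReal.inv_mul_cancel hq0 ENNReal.ofReal_ne_top, one_mul]

/-! ## B. The open gap at a unit in-offset and the neighbour average -/

/-- **The open gap of the `κ`-summed `(1,2)` block at a unit in-offset**: at `Letters.perc d p`,
`Σ_x Σ_κ Ā'^{κ,1,2}(0, e_ι′, x, x+y) = ofReal (2dp · (D ⋆ τ_p^{⋆2})(e_ι′ − y))` — the inner sum of the entry `(2,2)`
(`perc_abarIota22_inner_eq_ofReal`) at `w = e_ι′ − y`. `2 ≤ d`, `p < p_c`.
[cite: FitznerVanDerHofstad2017, App. B Table "Ā^{ι,a,b}(0,v,x,y)" rows (1,2), (2,2) (arXiv:1506.07977v2 p. 78); §5.1 "Elements of the bounds" (p. 49)]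
[cite: FitznerVanDerHofstad2016NoBLE, §5.3.1 (PTRF 169 (2017) p. 1093)] -/
theorem perc_openGap_abar12_stepVec (hd : 2 ≤ d) (p : unitInterval) (hp : p < criticalProbI d)
    (ι : Fin d × Bool) (y : Site d) :
    openGap (fun u v x t => ∑ κ : Fin d × Bool, blockAbar' (Letters.perc d p) κ 1 2 u v x t) (stepVec ι) y =
      ENNReal.ofReal (2 * d * (p : ℝ) *
        latticeConv (convPow (srwStep d) 1) (convPow (tau d p 0) 2) (stepVec ι - y)) := by
  show (∑' x, ∑ κ : Fin d × Bool, blockAbar' (Letters.perc d p) κ 1 2 0 (stepVec ι) x (x + y)) = _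
  simp_rw [perc_blockAbar'_one_two_stepVec]
  exact perc_abarIota22_inner_eq_ofReal hd p hp (stepVec ι - y)

/-- **The neighbour average produces the second `D`**: `Σ_ι′ (D ⋆ τ_p^{⋆2})(e_ι′ − y) = 2d · (D^{⋆2} ⋆ τ_p^{⋆2})(y)`
(evenness of `D ⋆ τ_p^{⋆2}`, `Σ_κ g(y − e_κ) = 2d (D ⋆ g)(y)` (`sum_stepVec_eq_two_d_mul_latticeConv_srwStep`), and the
re-association `D ⋆ (D ⋆ τ_p^{⋆2}) = D^{⋆2} ⋆ τ_p^{⋆2}` in `ℓ¹ ∩ ℓ^∞` (`latticeConv_assoc_of_bdd`: `D ∈ ℓ¹`,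
`|τ_p^{⋆2}| ≤ Σ τ_p` for `p < p_c`)). `2 ≤ d`, `p < p_c`.
[cite: FitznerVanDerHofstad2017, §4.2 (4.10) (arXiv:1506.07977v2 p. 35); §5.1 "Elements of the bounds" (p. 49)]
[cite: FitznerVanDerHofstad2016NoBLE, (1.1)–(1.3); §5.3.2 first display (PTRF 169 (2017) p. 1097)] -/
theorem sum_stepVec_sub_eq_two_d_mul_srwConvTau_two_two (hd : 2 ≤ d) (p : unitInterval) (hp : p < criticalProbI d)
    (y : Site d) :
    ∑ ι : Fin d × Bool, latticeConv (convPow (srwStep d) 1) (convPow (tau d p 0) 2) (stepVec ι - y) =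
      2 * d * latticeConv (convPow (srwStep d) 2) (convPow (tau d p 0) 2) y := by
  have hp' : (p : ℝ) < criticalProb (zdGraph d) (0 : Site d) := hp
  have hτ1 : Summable fun x => |tau d p 0 x| := (summable_tau_of_lt_criticalProb hd p hp').abs
  have hD1 : Summable fun x => |srwStep d x| := summable_srwStep.abs
  have hτbd : ∀ x, |tau d p 0 x| ≤ 1 := fun x => by
    rw [abs_of_nonneg (tau_nonneg p 0 x)]
    exact tau_le_one p 0 x
  have h2bd : ∀ x, |convPow (tau d p 0) 2 x| ≤ (∑' z, |tau d p 0 z|) * 1 := fun x => by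
    rw [show convPow (tau d p 0) 2 = latticeConv (convPow (tau d p 0) 1) (tau d p 0) from rfl, convPow_one_eq]
    exact abs_latticeConv_le_of_bdd hτ1 hτbd x
  rw [convPow_one_eq]
  have hGneg : ∀ z, latticeConv (srwStep d) (convPow (tau d p 0) 2) (-z) =
      latticeConv (srwStep d) (convPow (tau d p 0) 2) z := fun z =>
    latticeConv_neg srwStep_neg (convPow_tau_neg p 2) z
  have hre : ∀ ι : Fin d × Bool, latticeConv (srwStep d) (convPow (tau d p 0) 2) (stepVec ι - y) =
      latticeConv (srwStep d) (convPow (tau d p 0) 2) (y - stepVec ι) := fun ι => by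
    rw [← hGneg, neg_sub]
  simp_rw [hre]
  rw [sum_stepVec_eq_two_d_mul_latticeConv_srwStep (by omega), ← latticeConv_assoc_of_bdd hD1 hD1 h2bd y]
  show _ = 2 * d * latticeConv (latticeConv (convPow (srwStep d) 1) (srwStep d)) (convPow (tau d p 0) 2) y
  rw [convPow_one_eq]

/-! ## C. The `y`-member of the averaged entry -/

/-- **The `y`-member of the averaged entry `(1,2)` is at most `2dp Γ̄₂² K_{2,2}(0)`** at `Letters.perc d p`:
`(2d)⁻¹ Σ_ι′ Σ_x Σ_κ Ā'^{κ,1,2}(0,e_ι′,x,x+y) = 2dp (D^{⋆2} ⋆ τ_p^{⋆2})(y)` (§B), then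
`srwConvTau_le_nobleSup2_pow_mul_srwK (n := 2) (m := 2)` (`2·2+1 ≤ d`) and `srwK_le_srwK_zero`. `5 ≤ d`, `p < p_c`.
[cite: FitznerVanDerHofstad2017, §5.1 "Elements of the bounds" (arXiv:1506.07977v2 p. 49) with §6.1 p. 59; App. B row (1,2) (p. 78)]
[cite: FitznerVanDerHofstad2016NoBLE, §5.3.1 (5.26) and the display before it (PTRF 169 (2017) pp. 1093–1094); (3.34), (3.36) (p. 1071)] -/
theorem perc_abarAvg12_member_le (hd : 5 ≤ d) (p : unitInterval) (hp : p < criticalProbI d) (y : Site d) :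
    avgOn (unitVecs d)
        (fun v => openGap (fun u v x t => ∑ κ : Fin d × Bool, blockAbar' (Letters.perc d p) κ 1 2 u v x t) v y) ≤
      ENNReal.ofReal (2 * d * (p : ℝ) * (nobleSup2 d p ^ 2 * srwK d 2 2 0)) := by
  have hd2 : 2 ≤ d := by omega
  have hp0 : 0 ≤ (p : ℝ) := p.2.1
  have h2dp : 0 ≤ 2 * d * (p : ℝ) := by positivity
  have h2d : (0 : ℝ) ≤ 2 * d := by positivity
  have hG0 : ∀ z, 0 ≤ latticeConv (convPow (srwStep d) 1) (convPow (tau d p 0) 2) z := fun z =>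
    latticeConv_nonneg (fun x => convPow_srwStep_nonneg 1 x) (fun x => convPow_tau_nonneg p 2 x) z
  have hX0 : 0 ≤ latticeConv (convPow (srwStep d) 2) (convPow (tau d p 0) 2) y :=
    latticeConv_nonneg (fun x => convPow_srwStep_nonneg 2 x) (fun x => convPow_tau_nonneg p 2 x) y
  rw [avgOn_unitVecs]
  simp_rw [perc_openGap_abar12_stepVec hd2 p hp]
  rw [← ENNReal.ofReal_sum_of_nonneg (fun ι _ => mul_nonneg h2dp (hG0 _)), ← Finset.mul_sum,
    sum_stepVec_sub_eq_two_d_mul_srwConvTau_two_two hd2 p hp y]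
  refine ENNReal.div_le_of_le_mul ?_
  have hcast : (2 * (d : ℝ≥0∞)) = ENNReal.ofReal (2 * d : ℝ) := by
    rw [show (2 * d : ℝ) = ((2 * d : ℕ) : ℝ) by push_cast; ring, ENNReal.ofReal_natCast]
    push_cast
    ring
  rw [hcast, ← ENNReal.ofReal_mul (mul_nonneg h2dp (mul_nonneg (pow_nonneg (nobleSup2_nonneg' p) 2)
    (srwK_nonneg 2 2 0)))]
  refine ENNReal.ofReal_le_ofReal ?_
  calc 2 * d * (p : ℝ) * (2 * d * latticeConv (convPow (srwStep d) 2) (convPow (tau d p 0) 2) y)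
      = 2 * d * (p : ℝ) * latticeConv (convPow (srwStep d) 2) (convPow (tau d p 0) 2) y * (2 * d) := by ring
    _ ≤ 2 * d * (p : ℝ) * (nobleSup2 d p ^ 2 * srwK d 2 2 0) * (2 * d) := by
        refine mul_le_mul_of_nonneg_right (mul_le_mul_of_nonneg_left ?_ h2dp) h2d
        exact (srwConvTau_le_nobleSup2_pow_mul_srwK (n := 2) (by omega) (by omega) p hp 2 y).trans
          (mul_le_mul_of_nonneg_left (srwK_le_srwK_zero (n := 2) (by omega) 2 y)
            (pow_nonneg (nobleSup2_nonneg' p) 2))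

/-! ## D. The averaged entry `(1,2)` -/

/-- **`(Ā^ι)^{avg}_{1,2} ≤ 2dp · Γ̄₂² · K_{2,2}(0)`** at `Letters.perc d p` (`Γ̄₂ = nobleSup2 d p`), for the
class-averaged matrix of `BlockSummationAvg` with in-class `1̲` averaged over `unitVecs d` (any selector with
`avg 1 = true`, `avg 2 = false`): `matAbarAvg_apply`, `normOOavg_true_false`, the member bound
`perc_abarAvg12_member_le` for every out-offset `y`, and `iSup_le`. `5 ≤ d`, `p < p_c`.
[cite: FitznerVanDerHofstad2017, §5.1 "Elements of the bounds" (arXiv:1506.07977v2 p. 49) with §6.1 p. 59 "we include the information that either u,w and/or z,t are neighbors"; App. B row (1,2) (p. 78); notebook Percolation.nb (`Bound[AiotaBar,1,2,s]`)]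
[cite: FitznerVanDerHofstad2016NoBLE, §5.3.1 (5.26) (PTRF 169 (2017) p. 1094); (3.34), (3.36) (p. 1071)] -/
theorem perc_matAbarAvg'_one_two_le_ofReal_sup2 (hd : 5 ≤ d) (p : unitInterval) (hp : p < criticalProbI d)
    {avg : Fin 3 → Bool} (h1 : avg 1 = true) (h2 : avg 2 = false) :
    matAbarAvg (unitVecs d) avg (blockAbar' (Letters.perc d p)) 1 2 ≤
      ENNReal.ofReal (2 * d * (p : ℝ) * (nobleSup2 d p ^ 2 * srwK d 2 2 0)) := by
  rw [matAbarAvg_apply, h1, h2, normOOavg_true_false]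
  exact iSup_le fun y => perc_abarAvg12_member_le hd p hp y

/-- **The notebook cell for the averaged entry `(1,2)`**:
`matAbarAvg (unitVecs d) avg (blockAbar' (Letters.perc d p)) 1 2 ≤ ofReal (2dp · (((2d−2)/(2d−1)) Γ₂)² · K_{2,2}(0))`
under `nobleF2 d p ≤ Γ₂` (`Γ̄₂ ≤ ((2d−2)/(2d−1)) Γ₂`, `nobleSup2_le_of_nobleF2_le`) — `Bound[AiotaBar,1,2,s] =
(2d z) Γ̄₂² K_{2,2}(0)` read at `z = p`. `5 ≤ d`, `p < p_c`.
[cite: FitznerVanDerHofstad2017, §5.1 "Elements of the bounds" (arXiv:1506.07977v2 p. 49) with §6.1 p. 59; App. B row (1,2) (p. 78); notebook Percolation.nb]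
[cite: FitznerVanDerHofstad2016NoBLE, §5.3.1 (5.26) (PTRF 169 (2017) p. 1094); (2.6)] -/
theorem perc_matAbarAvg'_one_two_le_ofReal (hd : 5 ≤ d) (p : unitInterval) (hp : p < criticalProbI d)
    {avg : Fin 3 → Bool} (h1 : avg 1 = true) (h2 : avg 2 = false) {Γ₂ : ℝ} (hΓ2 : nobleF2 d p ≤ Γ₂) :
    matAbarAvg (unitVecs d) avg (blockAbar' (Letters.perc d p)) 1 2 ≤
      ENNReal.ofReal (2 * d * (p : ℝ) * (((2 * d - 2) / (2 * d - 1) * Γ₂) ^ 2 * srwK d 2 2 0)) := by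
  have h2dp : 0 ≤ 2 * d * (p : ℝ) := by have := p.2.1; positivity
  exact (perc_matAbarAvg'_one_two_le_ofReal_sup2 hd p hp h1 h2).trans (ENNReal.ofReal_le_ofReal
    (mul_le_mul_of_nonneg_left (mul_le_mul_of_nonneg_right
      (pow_le_pow_left₀ (nobleSup2_nonneg' p) (nobleSup2_le_of_nobleF2_le (by omega) p hΓ2) 2) (srwK_nonneg 2 2 0))
      h2dp))

/-- **The notebook cell for the averaged entry `(1,2)`, both constants**:
`matAbarAvg (unitVecs d) avg (blockAbar' (Letters.perc d p)) 1 2 ≤ ofReal ((2d/(2d−1)) Γ₁ · (((2d−2)/(2d−1)) Γ₂)² · K_{2,2}(0))`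
under `(2d−1) p ≤ Γ₁` (`2dp ≤ (2d/(2d−1)) Γ₁`, `two_d_mul_le_of_le`) and `nobleF2 d p ≤ Γ₂`. `5 ≤ d`, `p < p_c`.
[cite: FitznerVanDerHofstad2017, §5.1 "Elements of the bounds" (arXiv:1506.07977v2 p. 49) with §6.1 p. 59; App. B row (1,2) (p. 78)]
[cite: FitznerVanDerHofstad2016NoBLE, §5.3.1 (5.13), (5.26) (PTRF 169 (2017) pp. 1092–1094); (2.6)] -/
theorem perc_matAbarAvg'_one_two_le_ofReal_printed (hd : 5 ≤ d) (p : unitInterval) (hp : p < criticalProbI d)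
    {avg : Fin 3 → Bool} (h1 : avg 1 = true) (h2 : avg 2 = false) {Γ₁ Γ₂ : ℝ}
    (hΓ1 : (2 * d - 1) * (p : ℝ) ≤ Γ₁) (hΓ2 : nobleF2 d p ≤ Γ₂) :
    matAbarAvg (unitVecs d) avg (blockAbar' (Letters.perc d p)) 1 2 ≤
      ENNReal.ofReal (2 * d / (2 * d - 1) * Γ₁ * (((2 * d - 2) / (2 * d - 1) * Γ₂) ^ 2 * srwK d 2 2 0)) :=
  (perc_matAbarAvg'_one_two_le_ofReal hd p hp h1 h2 hΓ2).trans (ENNReal.ofReal_le_ofReal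
    (mul_le_mul_of_nonneg_right (two_d_mul_le_of_le (by omega) p hΓ1) (mul_nonneg (sq_nonneg _) (srwK_nonneg 2 2 0))))

end Literature.Probability.FitznerVanDerHofstad2017
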